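import Literature.NumberTheory.EllipticCurves.SelmerFiniteProofs
import Literature.NumberTheory.EllipticCurves.CanonicalPAdicHeightKLocusProofs
import Literature.NumberTheory.EllipticCurves.KodairaNeronUnramified
import Literature.NumberTheory.EllipticCurves.TamagawaVariableChangeProofs
import Mathlib.RingTheory.DedekindDomain.AdicValuation
import HarnessLib

/-!
# `E₀` along field embeddings: the place of a number field cut out by an embedding into `K̄_v`,
# invariance of "nonsingular reduction" under valued-field extension and under integral changes
# of variables (Silverman, *AEC*, VII.§1–§2)

Topic `NumberTheory/EllipticCurves`. THEOREMS ONLY (no definition, no named fact, no `sorry`).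
Cell `bsd-jet` (T1 JET, road K), seat `bsd-jet-ty` g8: the kernel plumbing ("G-rec") behind the
by-name discharge of the END FORMs' cite-only schema `hGZ` from the Literature fact
`Gross1991_heegnerPoint_sub_ratTorsion_mem_E0` (`HeegnerPointsIdentityComponent`): that fact speaks
of `E₀(K[n])_w` — nonsingular reduction on the model `W` at a finite place `w` of the ring class
field (`placeIntModel`, `WeierstrassCurve.HasNonsingularReduction`) — while the consumers
(`X11b.E0Receptacle (W⁄K) v ≤ E(K̄_v)`) read `E⁰` inside `E(K̄_v)` through the spectral valuation
`|·|_v`, a chosen structure map and a chosen change of variables to the local minimal model. The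
three elementary facts that bridge the two readings are proved here in general form:

* §1 `exists_heightOneSpectrum_isEquiv_comap` — **the place cut out by an embedding.** For a
  number field `L`, a finite place `v` of a number field `K` and ANY ring homomorphism
  `e : L → K̄_v`, there is a finite place `w` of `L` whose valuation is equivalent
  (`Valuation.IsEquiv`) to the pull-back `|e(·)|_v` of the spectral valuation, and `w` lies over `v`
  on the naturals (`n ∈ v ⇒ n ∈ w`). (Neukirch, *ANT*, II (8.1): the extensions of `v` to `L`
  correspond to the embeddings `L → K̄_v`; here only the easy direction "embedding ⇒ place", via
  Mathlib's `valuationSubringAtPrime_eq_valuationSubring` and `ValuationSubring.eq_of_le_of_ne_top`.)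
* §2 `hasNonsingularReduction_some_iff_of_ringHom` — **`E₀` is invariant under extension of valued
  fields** for a fixed equation: if `f : L → Ω` carries the valuation ring of `w₁` onto its trace of
  the valuation ring of `w₂` (`w₁ z ≤ 1 ↔ w₂ (f z) ≤ 1`) and `W₂ = W₁^φ` for the induced local
  homomorphism `φ` of valuation rings, then `(f x, f y) ∈ E₀(W₂)` iff `(x, y) ∈ E₀(W₁)` (the residue
  field extension is injective and fixes the reduced equation; Mathlib `Affine.map_nonsingular`);
  specialised in `reducesToNonsingular_some_iff_hasNonsingularReduction_intModel` to the tree's two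
  currencies: `ReducesToNonsingular` for an `ℝ≥0`-valuation on `Ω` (`KodairaNeronUnramified`) versus
  `HasNonsingularReduction` on the integral model `intModel W L w₁` of a curve `W/ℚ` with integer
  coefficients (`CanonicalPAdicHeightKLocusProofs`).
* §3 `hasNonsingularReduction_variableChange_some_iff` — **`E₀` is invariant under an `R`-integral
  change of variables** (`u ∈ R*`, `r, s, t ∈ R`): Silverman, *AEC*, VII.§2 (PDF p. 166), the
  `ReductionHomomorphism` twin of the tree's `isNonsingularReductionPoint_pointEquiv_iff`
  (`TamagawaVariableChangeProofs`), over an arbitrary local ring `R ⊆ Ω`.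

Statements are at the level of COORDINATES (`.some x y h`): consumers push points through the
`congrEquiv` / `Point.map` / `pointEquiv` transports by their `_some` lemmas.

## References

* [SilvermanAEC2009] J. H. Silverman, *The Arithmetic of Elliptic Curves*, 2nd ed., GTM 106 (2009):
  VII.§1 Prop. 1.3(b) (PDF p. 165), VII.§2 (reduction modulo `π`, `E₀`, Prop. VII.2.1; PDF
  pp. 166–167).
* [NeukirchANT1999] J. Neukirch, *Algebraic Number Theory* (1999), Ch. II (4.8), (8.1).

presearch (D-0021): `lean search` for `IsEquiv.*comap`, `hasNonsingularReduction.*ringHom`,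
`…variableChange` → nothing of this shape; nearest tree items `reducesToNonsingular_map_iff_of_forall_eq`,
`isNonsingularReductionPoint_pointEquiv_iff`, `reducesToNonsingular_mapPoint_iff_of_tateNormalForm` (patterns).
-/

noncomputable section

open scoped NNReal
open NumberField IsDedekindDomain WeierstrassCurve

universe u v

namespace Literature.NumberTheory.EllipticCurves

/-! ## §1 The place of a number field cut out by an embedding into `K̄_v` -/

section PlaceOfEmbedding

open IsDedekindDomain.HeightOneSpectrum

variable {K : Type u} [Field K] [NumberField K] {v : HeightOneSpectrum (𝓞 K)}
  {w₀ : Valuation (AlgebraicClosure (v.adicCompletion K)) ℝ≥0}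
  (hw₀ : ∀ x, (w₀ x : ℝ) =
    spectralNorm (v.adicCompletion K) (AlgebraicClosure (v.adicCompletion K)) x)
include hw₀

/-- A global integer inside `v` has spectral valuation `< 1` in `K̄_v` (and conversely).
[folklore] -/
private theorem spectralValuation_algebraMap_ringOfIntegers_lt_one_iff (x : 𝓞 K) :
    w₀ (algebraMap (𝓞 K) (AlgebraicClosure (v.adicCompletion K)) x) < 1 ↔ x ∈ v.asIdeal := by
  rw [← NNReal.coe_lt_coe, algebraMap_ringOfIntegers_algClosure_apply,
    coe_spectralValuation_algebraMap hw₀, NNReal.coe_one, Valued.toNormedField.norm_lt_one_iff,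
    valuedAdicCompletion_eq_valuation']
  exact v.valuation_lt_one_iff_mem x

/-- A natural number inside `v` has spectral valuation `< 1` in `K̄_v`. [folklore] -/
private theorem spectralValuation_natCast_lt_one {n : ℕ} (hn : (n : 𝓞 K) ∈ v.asIdeal) :
    w₀ (n : AlgebraicClosure (v.adicCompletion K)) < 1 := by
  rw [← map_natCast (algebraMap (𝓞 K) (AlgebraicClosure (v.adicCompletion K))) n]
  exact (spectralValuation_algebraMap_ringOfIntegers_lt_one_iff hw₀ _).mpr hn

variable {L : Type v} [Field L] [NumberField L]
  (e : L →+* AlgebraicClosure (v.adicCompletion K))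

omit [NumberField L] in
/-- **Integers of `L` are `|·|_v`-integral along any embedding `e : L → K̄_v`** (they are integral
over `ℤ ⊆ 𝓞_v`, and the valuation ring of `K̄_v` is the integral closure of `𝓞_v`, Neukirch II
(4.8)). [cite: NeukirchANT1999, Ch. II (4.8)] -/
theorem spectralValuation_ringOfIntegers_le_one (z : 𝓞 L) :
    w₀ (e (algebraMap (𝓞 L) L z)) ≤ 1 := by
  obtain ⟨p, hp, hpz⟩ := RingOfIntegers.isIntegral_coe z
  have h1 : IsIntegral (v.adicCompletionIntegers K) (e (algebraMap (𝓞 L) L z)) := by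
    refine ⟨p.map (Int.castRingHom _), hp.map _, ?_⟩
    have hcomp : (algebraMap (v.adicCompletionIntegers K) (AlgebraicClosure (v.adicCompletion K))).comp
        (Int.castRingHom (v.adicCompletionIntegers K)) = e.comp (algebraMap ℤ L) :=
      RingHom.ext_int _ _
    rw [Polynomial.eval₂_map, hcomp, ← Polynomial.hom_eval₂, hpz, map_zero]
  exact (mem_localAbsIntegers_iff_spectralValuation hw₀).mp
    ((mem_integralClosure_iff _ _).mpr h1)

/-- **The finite place of a number field cut out by an embedding into `K̄_v`.** For a number field
`L` and a ring homomorphism `e : L → K̄_v` (`K̄_v = \overline{K_v}`, `v` a finite place of the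
number field `K`, `|·|_v` the spectral valuation), there is a finite place `w` of `L` whose
valuation is EQUIVALENT to `z ↦ |e z|_v` (same valuation ring; hence `≤ 1`, `< 1`, `= 1` are
exchanged, `Valuation.IsEquiv`), and `w ∣ v` in the sense that every natural number in `v` lies in
`w`. The prime of `w` is `{z ∈ 𝓞 L : |e z|_v < 1}`; its valuation ring is the localisation of
`𝓞 L` there (Mathlib `valuationSubringAtPrime_eq_valuationSubring`), which is maximal among proper
valuation subrings (`ValuationSubring.eq_of_le_of_ne_top`). Neukirch, *ANT*, II (8.1).
[cite: NeukirchANT1999, Ch. II (8.1)] -/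
theorem exists_heightOneSpectrum_isEquiv_comap :
    ∃ w : HeightOneSpectrum (𝓞 L), (w.valuation L).IsEquiv (w₀.comap e) ∧
      ∀ n : ℕ, (n : 𝓞 K) ∈ v.asIdeal → (n : 𝓞 L) ∈ w.asIdeal := by
  have hint := spectralValuation_ringOfIntegers_le_one hw₀ e
  -- the prime `{z ∈ 𝓞 L : |e z|_v < 1}`
  let I : Ideal (𝓞 L) :=
    { carrier := {z | w₀ (e (algebraMap (𝓞 L) L z)) < 1}
      add_mem' := fun {a b} ha hb ↦ by
        simp only [Set.mem_setOf_eq, map_add] at ha hb ⊢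
        exact (w₀.map_add _ _).trans_lt (max_lt ha hb)
      zero_mem' := by simp
      smul_mem' := fun c {z} hz ↦ by
        simp only [Set.mem_setOf_eq, smul_eq_mul, map_mul] at hz ⊢
        exact (mul_le_of_le_one_left zero_le (hint c)).trans_lt hz }
  have hmemI : ∀ z : 𝓞 L, z ∈ I ↔ w₀ (e (algebraMap (𝓞 L) L z)) < 1 := fun z ↦ Iff.rfl
  have heq1 : ∀ z : 𝓞 L, z ∉ I → w₀ (e (algebraMap (𝓞 L) L z)) = 1 := fun z hz ↦
    le_antisymm (hint z) (not_lt.mp ((hmemI z).not.mp hz))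
  have hprime : I.IsPrime := by
    refine ⟨fun htop ↦ ?_, fun {a b} hab ↦ ?_⟩
    · have h1 : (1 : 𝓞 L) ∈ I := htop ▸ Submodule.mem_top
      rw [hmemI, map_one, map_one, map_one] at h1
      exact lt_irrefl _ h1
    · by_cases ha : a ∈ I
      · exact Or.inl ha
      by_cases hb : b ∈ I
      · exact Or.inr hb
      rw [hmemI, map_mul, map_mul, map_mul, heq1 a ha, heq1 b hb, mul_one] at hab
      exact absurd hab (lt_irrefl _)
  -- naturals in `v` lie in `I`
  have hnat : ∀ n : ℕ, (n : 𝓞 K) ∈ v.asIdeal → (n : 𝓞 L) ∈ I := fun n hn ↦ by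
    rw [hmemI, map_natCast, map_natCast]
    exact spectralValuation_natCast_lt_one hw₀ hn
  -- a non-zero natural number in `v`
  have hN0 : Ideal.absNorm v.asIdeal ≠ 0 := fun h ↦ v.ne_bot (Ideal.absNorm_eq_zero_iff.mp h)
  have hNv : ((Ideal.absNorm v.asIdeal : ℕ) : 𝓞 K) ∈ v.asIdeal := Ideal.absNorm_mem v.asIdeal
  have hbot : I ≠ ⊥ := fun h ↦ by
    have hmem := hnat _ hNv
    rw [h, Ideal.mem_bot, Nat.cast_eq_zero] at hmem
    exact hN0 hmem
  let w : HeightOneSpectrum (𝓞 L) := ⟨I, hprime, hbot⟩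
  refine ⟨w, ?_, hnat⟩
  rw [Valuation.isEquiv_iff_valuationSubring, ← valuationSubringAtPrime_eq_valuationSubring]
  refine ValuationSubring.eq_of_le_of_ne_top _ ?_ ?_
  · -- the localisation of `𝓞 L` at `I` is `|e ·|_v`-integral
    rintro x ⟨a, s, hs, rfl⟩
    have hs1 : w₀ (e (algebraMap (𝓞 L) L s)) = 1 := heq1 s hs
    rw [Valuation.mem_valuationSubring_iff, Valuation.comap_apply, map_mul, map_inv₀, map_mul,
      map_inv₀, hs1, inv_one, mul_one]
    exact hint a
  · -- `|e ·|_v` is a proper valuation ring: `1/N ∉` for `N = #(𝓞 K / v) ∈ v`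
    haveI : CharZero (AlgebraicClosure (v.adicCompletion K)) :=
      charZero_of_injective_algebraMap (algebraMap K _).injective
    intro htop
    have hmem : ((Ideal.absNorm v.asIdeal : ℕ) : L)⁻¹ ∈ (w₀.comap e).valuationSubring :=
      htop ▸ ValuationSubring.mem_top _
    rw [Valuation.mem_valuationSubring_iff, Valuation.comap_apply, map_inv₀, map_natCast,
      map_inv₀] at hmem
    have hlt : w₀ (Ideal.absNorm v.asIdeal : AlgebraicClosure (v.adicCompletion K)) < 1 :=
      spectralValuation_natCast_lt_one hw₀ hNv
    have hpos : 0 < w₀ (Ideal.absNorm v.asIdeal : AlgebraicClosure (v.adicCompletion K)) :=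
      (Valuation.pos_iff _).mpr (Nat.cast_ne_zero.mpr hN0)
    exact absurd hmem (not_le.mpr ((one_lt_inv₀ hpos).mpr hlt))

end PlaceOfEmbedding

/-! ## §2 `E₀` is invariant under extension of valued fields (fixed equation) -/

section Transport

variable {L : Type u} [Field L] {Γ₁ : Type*} [LinearOrderedCommGroupWithZero Γ₁]
  {w₁ : Valuation L Γ₁} {R₁ : Type*} [CommRing R₁] [IsLocalRing R₁] [Algebra R₁ L]
  {Ω : Type v} [Field Ω] {Γ₂ : Type*} [LinearOrderedCommGroupWithZero Γ₂]
  {w₂ : Valuation Ω Γ₂} {R₂ : Type*} [CommRing R₂] [IsLocalRing R₂] [Algebra R₂ Ω]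

/-- For a valuation `w` and `z ≠ 0`: `w z = 1 ↔ (w z ≤ 1 ∧ w z⁻¹ ≤ 1)`. [folklore] -/
private theorem valuation_eq_one_iff_le_one_and_inv_le_one {F : Type*} [Field F] {Γ : Type*}
    [LinearOrderedCommGroupWithZero Γ] (w : Valuation F Γ) {z : F} (hz : z ≠ 0) :
    w z = 1 ↔ w z ≤ 1 ∧ w z⁻¹ ≤ 1 := by
  rw [map_inv₀, inv_le_one₀ ((Valuation.pos_iff w).mpr hz), le_antisymm_iff]

/-- If `f : L → Ω` satisfies `w₁ z ≤ 1 ↔ w₂ (f z) ≤ 1`, then also `w₁ z = 1 ↔ w₂ (f z) = 1`.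
[folklore] -/
private theorem valuation_eq_one_iff_of_ringHom (f : L →+* Ω) (hf : ∀ z, w₁ z ≤ 1 ↔ w₂ (f z) ≤ 1)
    (z : L) : w₁ z = 1 ↔ w₂ (f z) = 1 := by
  by_cases hz : z = 0
  · subst hz; simp
  · rw [valuation_eq_one_iff_le_one_and_inv_le_one w₁ hz,
      valuation_eq_one_iff_le_one_and_inv_le_one w₂ ((map_ne_zero f).mpr hz), hf z, ← map_inv₀ f,
      hf z⁻¹]

/-- **`E₀` is invariant under extension of valued fields for a fixed equation** (coordinate form).
Let `(L, w₁) → (Ω, w₂)` be a homomorphism of valued fields in the weak sense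
`w₁ z ≤ 1 ↔ w₂ (f z) ≤ 1`, `R₁ ⊆ L`, `R₂ ⊆ Ω` their valuation rings (local rings with
`wᵢ.Integers Rᵢ`), `φ : R₁ → R₂` the restriction of `f`, and `W₂ = W₁^φ` Weierstrass equations over
them. Then for a point `(x, y)` of `W₁ ⊗ L`: `(f x, f y) ∈ E₀(W₂)` iff `(x, y) ∈ E₀(W₁)`
(Silverman's `E₀ = {P : P̃ ∈ Ẽ_ns}`: integrality of `x` is preserved and reflected; on integral
points the reduced coordinates are related by the residue-field homomorphism `φ̄ : k₁ → k₂`,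
injective and fixing the reduced equation, under which nonsingularity is invariant, Mathlib
`Affine.map_nonsingular`). Silverman, *AEC*, VII.§2 (PDF pp. 166–167); Neukirch II §8.
[cite: SilvermanAEC2009, VII.§2 (definition of `E₀`, PDF p. 167)] -/
theorem hasNonsingularReduction_some_iff_of_ringHom (hv₁ : w₁.Integers R₁) (hv₂ : w₂.Integers R₂)
    (f : L →+* Ω) (φ : R₁ →+* R₂) (hφ : ∀ a, algebraMap R₂ Ω (φ a) = f (algebraMap R₁ L a))
    (hf : ∀ z, w₁ z ≤ 1 ↔ w₂ (f z) ≤ 1) {W₁ : WeierstrassCurve R₁} {W₂ : WeierstrassCurve R₂}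
    (hW : W₁.map φ = W₂) {x y : L} (h₁ : (W₁.baseChange L).toAffine.Nonsingular x y)
    (h₂ : (W₂.baseChange Ω).toAffine.Nonsingular (f x) (f y)) :
    W₂.HasNonsingularReduction (.some _ _ h₂) ↔ W₁.HasNonsingularReduction (.some x y h₁) := by
  have hinj₁ := hv₁.hom_inj
  have hinj₂ := hv₂.hom_inj
  -- `φ` is local
  haveI : IsLocalHom φ := ⟨fun a ha ↦ by
    rw [hv₂.isUnit_iff_valuation_eq_one, hφ] at ha
    rw [hv₁.isUnit_iff_valuation_eq_one]
    exact (valuation_eq_one_iff_of_ringHom f hf _).mpr ha⟩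
  -- the residue-field homomorphism fixes the reduced equation
  set σ : IsLocalRing.ResidueField R₁ →+* IsLocalRing.ResidueField R₂ :=
    IsLocalRing.ResidueField.map φ with hσdef
  have hσ : ∀ a, σ (IsLocalRing.residue R₁ a) = IsLocalRing.residue R₂ (φ a) := fun a ↦ by
    rw [hσdef]; rfl
  have hred : (W₁.map (IsLocalRing.residue R₁)).map σ = W₂.map (IsLocalRing.residue R₂) := by
    rw [← hW, WeierstrassCurve.map_map, WeierstrassCurve.map_map,
      show σ.comp (IsLocalRing.residue R₁) = (IsLocalRing.residue R₂).comp φ from RingHom.ext hσ]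
  by_cases hx : w₁ x ≤ 1
  · -- integral point: compare the reduced points along `σ`
    have hy : w₁ y ≤ 1 := v_Y_le_one_of_v_X_le_one hv₁ h₁.1 hx
    obtain ⟨x₁, rfl⟩ := hv₁.exists_of_le_one hx
    obtain ⟨y₁, rfl⟩ := hv₁.exists_of_le_one hy
    have h₂' : (W₂.baseChange Ω).toAffine.Nonsingular (algebraMap R₂ Ω (φ x₁))
        (algebraMap R₂ Ω (φ y₁)) := by rwa [hφ, hφ]
    have hpt : (Affine.Point.some _ _ h₂ : (W₂.baseChange Ω).toAffine.Point) = .some _ _ h₂' :=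
      point_some_congr (hφ x₁).symm (hφ y₁).symm
    rw [hpt, hasNonsingularReduction_some_algebraMap_iff hinj₂,
      hasNonsingularReduction_some_algebraMap_iff hinj₁, ← hred, ← hσ, ← hσ,
      Affine.map_nonsingular _ σ.injective]
  · -- non-integral point: in `E₁ ⊆ E₀` on both sides
    have hx₂ : ¬ w₂ (f x) ≤ 1 := fun h ↦ hx ((hf x).mpr h)
    exact iff_of_true (Or.inl ((not_mem_range_iff hv₂).mpr (not_le.mp hx₂)))
      (Or.inl ((not_mem_range_iff hv₁).mpr (not_le.mp hx)))

/-- The coefficients of `W ⊗ Ω` are the images of the integer coefficients of `W`, for `W/ℚ`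
with integer coefficients and any `ℚ`-algebra `Ω` (the tree's `exists_intCast_eq_baseChange`
without its number-field hypothesis, and with the integers named). [folklore] -/
private theorem baseChange_coeff_eq_intCast (W : WeierstrassCurve ℚ) [W.IsIntegral ℤ]
    (Ω : Type*) [CommRing Ω] [Algebra ℚ Ω] :
    (W.baseChange Ω).a₁ = ((W.integralModel ℤ).a₁ : ℤ) ∧
      (W.baseChange Ω).a₂ = ((W.integralModel ℤ).a₂ : ℤ) ∧
      (W.baseChange Ω).a₃ = ((W.integralModel ℤ).a₃ : ℤ) ∧
      (W.baseChange Ω).a₄ = ((W.integralModel ℤ).a₄ : ℤ) ∧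
      (W.baseChange Ω).a₆ = ((W.integralModel ℤ).a₆ : ℤ) := by
  refine ⟨?_, ?_, ?_, ?_, ?_⟩ <;>
  simp only [WeierstrassCurve.baseChange, WeierstrassCurve.map_a₁, WeierstrassCurve.map_a₂,
    WeierstrassCurve.map_a₃, WeierstrassCurve.map_a₄, WeierstrassCurve.map_a₆,
    ← WeierstrassCurve.integralModel_a₁_eq ℤ W, ← WeierstrassCurve.integralModel_a₂_eq ℤ W,
    ← WeierstrassCurve.integralModel_a₃_eq ℤ W, ← WeierstrassCurve.integralModel_a₄_eq ℤ W,
    ← WeierstrassCurve.integralModel_a₆_eq ℤ W, eq_intCast, map_intCast]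

/-- The coefficients of `W ⊗ Ω` are `w`-integral for any valuation `w` bounded by `1` on `ℤ`
(the tree's `valuation_coeff_baseChange_le_one` without its number-field hypothesis). [folklore] -/
private theorem valuation_coeff_baseChange_le_one_of_algebra (W : WeierstrassCurve ℚ) [W.IsIntegral ℤ]
    (Ω : Type*) [Field Ω] [Algebra ℚ Ω] {Γ : Type*} [LinearOrderedCommGroupWithZero Γ]
    (w : Valuation Ω Γ) (hw : ∀ m : ℤ, w (m : Ω) ≤ 1) :
    w (W.baseChange Ω).a₁ ≤ 1 ∧ w (W.baseChange Ω).a₂ ≤ 1 ∧ w (W.baseChange Ω).a₃ ≤ 1 ∧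
      w (W.baseChange Ω).a₄ ≤ 1 ∧ w (W.baseChange Ω).a₆ ≤ 1 := by
  obtain ⟨h₁, h₂, h₃, h₄, h₆⟩ := baseChange_coeff_eq_intCast W Ω
  rw [h₁, h₂, h₃, h₄, h₆]
  exact ⟨hw _, hw _, hw _, hw _, hw _⟩

/-- A ring homomorphism between `ℚ`-algebras carries the coefficients of `W ⊗ L` to those of
`W ⊗ Ω` (`W/ℚ` with integer coefficients). [folklore] -/
private theorem ringHom_coeff_baseChange (W : WeierstrassCurve ℚ) [W.IsIntegral ℤ] {L : Type*} [Field L]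
    [Algebra ℚ L] {Ω : Type*} [Field Ω] [Algebra ℚ Ω] (f : L →+* Ω) :
    f (W.baseChange L).a₁ = (W.baseChange Ω).a₁ ∧ f (W.baseChange L).a₂ = (W.baseChange Ω).a₂ ∧
      f (W.baseChange L).a₃ = (W.baseChange Ω).a₃ ∧ f (W.baseChange L).a₄ = (W.baseChange Ω).a₄ ∧
      f (W.baseChange L).a₆ = (W.baseChange Ω).a₆ := by
  obtain ⟨h₁, h₂, h₃, h₄, h₆⟩ := baseChange_coeff_eq_intCast W L
  obtain ⟨k₁, k₂, k₃, k₄, k₆⟩ := baseChange_coeff_eq_intCast W Ω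
  rw [h₁, h₂, h₃, h₄, h₆, k₁, k₂, k₃, k₄, k₆]
  exact ⟨map_intCast f _, map_intCast f _, map_intCast f _, map_intCast f _, map_intCast f _⟩

/-- **The two currencies of the tree agree along an embedding.** Let `W/ℚ` have integer
coefficients, `L` be a number field with a valuation `w₁` (bounded by `1` on `ℤ`) and `Ω` a field
with an `ℝ≥0`-valuation `w₂` (bounded by `1` on `ℤ`), `f : L → Ω` a ring homomorphism with
`w₁ z ≤ 1 ↔ w₂ (f z) ≤ 1`. Then for a point `(x, y) ∈ W(L)`: the point `(f x, f y) ∈ W(Ω)`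
*reduces to a nonsingular point* for `w₂` (`ReducesToNonsingular`, the `E₀(K̄_v)` of
`KodairaNeronUnramified`) iff `(x, y)` *has nonsingular reduction* on the integral model
`intModel W L w₁` (`WeierstrassCurve.HasNonsingularReduction`, the `E₀(L)_w` of
`CanonicalPAdicHeightKLocusProofs` / `HeegnerPointsIdentityComponent`). Silverman, *AEC*, VII.§2.
[cite: SilvermanAEC2009, VII.§2 (definition of `E₀`, PDF p. 167)] -/
theorem reducesToNonsingular_some_iff_hasNonsingularReduction_intModel (W : WeierstrassCurve ℚ)
    [W.IsIntegral ℤ] {L : Type u} [Field L] [NumberField L] {Γ₁ : Type*}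
    [LinearOrderedCommGroupWithZero Γ₁] {w₁ : Valuation L Γ₁} (h₁ : ∀ m : ℤ, w₁ (m : L) ≤ 1)
    {Ω : Type v} [Field Ω] [Algebra ℚ Ω] {w₂ : Valuation Ω ℝ≥0} (h₂ : ∀ m : ℤ, w₂ (m : Ω) ≤ 1)
    (f : L →+* Ω) (hf : ∀ z, w₁ z ≤ 1 ↔ w₂ (f z) ≤ 1) {x y : L}
    (hxy : (W.baseChange L).toAffine.Nonsingular x y)
    (hxy' : (W.baseChange Ω).toAffine.Nonsingular (f x) (f y)) :
    ReducesToNonsingular w₂ (IsLocalRing.residue w₂.integer)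
        (.some _ _ hxy' : (W.baseChange Ω).toAffine.Point) ↔
      (intModel W L w₁ h₁).HasNonsingularReduction (K := L) (.some x y hxy) := by
  -- the `𝒪_{w₂}`-model of `W ⊗ Ω`
  obtain ⟨c₁, c₂, c₃, c₄, c₆⟩ := valuation_coeff_baseChange_le_one_of_algebra W Ω w₂ h₂
  let M : WeierstrassCurve w₂.integer := ⟨⟨_, c₁⟩, ⟨_, c₂⟩, ⟨_, c₃⟩, ⟨_, c₄⟩, ⟨_, c₆⟩⟩
  -- the restriction of `f` to the valuation rings
  let φ : w₁.valuationSubring →+* w₂.integer :=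
    { toFun := fun a ↦ ⟨f (a : L), (hf (a : L)).mp ((Valuation.mem_valuationSubring_iff _ _).mp a.2)⟩
      map_one' := Subtype.ext (map_one f)
      map_mul' := fun a b ↦ Subtype.ext (map_mul f (a : L) (b : L))
      map_zero' := Subtype.ext (map_zero f)
      map_add' := fun a b ↦ Subtype.ext (map_add f (a : L) (b : L)) }
  have hφ : ∀ a, algebraMap w₂.integer Ω (φ a) = f (algebraMap w₁.valuationSubring L a) :=
    fun _ ↦ rfl
  -- `f` fixes the (integer) coefficients: `(intModel W L w₁)^φ = M`
  obtain ⟨d₁, d₂, d₃, d₄, d₆⟩ := ringHom_coeff_baseChange W f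
  have hW : (intModel W L w₁ h₁).map φ = M := by
    ext
    · exact d₁
    · exact d₂
    · exact d₃
    · exact d₄
    · exact d₆
  have key := hasNonsingularReduction_some_iff_of_ringHom (valuation_integers_valuationSubring w₁)
    (Valuation.integer.integers w₂) f φ hφ hf hW hxy (W₂ := M) hxy'
  rw [← key]
  exact reducesToNonsingular_iff_hasNonsingularReduction M _

end Transport

/-! ## §3 `E₀` is invariant under an integral change of variables -/

section VariableChange

variable {R : Type u} [CommRing R] [IsLocalRing R] {Ω : Type v} [Field Ω] [Algebra R Ω]

/-- **An `R`-integral change of variables preserves `E₀`** (coordinate form). For a local ring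
`R ⊆ Ω`, a Weierstrass equation `W₀` over `R` and a change of variables `D = (u, r, s, t)` OVER `R`
(`u ∈ R*`, `r, s, t ∈ R`), a point `(x, y)` of `W₀ ⊗ Ω` has nonsingular reduction iff its image
`(x', y') = (u⁻²(x − r), u⁻³(y − s(x − r) − t))` on `V ⊗ Ω`, `V = D • W₀`, has (the equation `V`
and the coordinates `x', y'` are taken up to propositional equality, for the consumers' casts): integrality of the `x`-coordinate is
preserved (`u ∈ R*`, `r ∈ R`), and on integral points the reduced coordinates are related by the
reduced change of variables `D̄`, which preserves nonsingularity (`VariableChange.nonsingular_iff`).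
The `HasNonsingularReduction` twin of the tree's `isNonsingularReductionPoint_pointEquiv_iff`
(`TamagawaVariableChangeProofs`, DVR currency). Silverman, *AEC*, VII.§2 (PDF p. 166: "this
change of coordinates … reduces to the standard change of coordinates for `Ẽ`"), with VII.1.3(b).
[cite: SilvermanAEC2009, VII.§2 (PDF p. 166)] -/
theorem hasNonsingularReduction_variableChange_some_iff (W₀ : WeierstrassCurve R)
    (D : VariableChange R) {V : WeierstrassCurve R} (hV : D • W₀ = V) {x y x' y' : Ω}
    (hx' : x' = (D.map (algebraMap R Ω)).toX x) (hy' : y' = (D.map (algebraMap R Ω)).toY x y)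
    (h : (W₀.baseChange Ω).toAffine.Nonsingular x y) (h' : (V.baseChange Ω).toAffine.Nonsingular x' y') :
    V.HasNonsingularReduction (.some x' y' h') ↔ W₀.HasNonsingularReduction (.some x y h) := by
  subst hV hx' hy'
  have hred : (D • W₀).map (IsLocalRing.residue R) =
      D.map (IsLocalRing.residue R) • W₀.map (IsLocalRing.residue R) := by
    rw [map_variableChange]
  simp only [WeierstrassCurve.HasNonsingularReduction]
  refine or_congr (not_congr ⟨?_, ?_⟩) ⟨?_, ?_⟩
  · rintro ⟨x₀', hx₀'⟩
    refine ⟨D.ofX x₀', ?_⟩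
    rw [VariableChange.ringHom_ofX, hx₀', VariableChange.ofX_toX]
  · rintro ⟨x₀, rfl⟩
    exact ⟨D.toX x₀, VariableChange.ringHom_toX _ _ _⟩
  · rintro ⟨x₀', y₀', hx, hy, hns⟩
    refine ⟨D.ofX x₀', D.ofY x₀' y₀', ?_, ?_, ?_⟩
    · rw [VariableChange.ringHom_ofX, hx, VariableChange.ofX_toX]
    · rw [VariableChange.ringHom_ofY, hx, hy, VariableChange.ofY_toY]
    · rw [VariableChange.ringHom_ofX, VariableChange.ringHom_ofY, VariableChange.nonsingular_ofXY_iff,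
        ← hred]
      exact hns
  · rintro ⟨x₀, y₀, rfl, rfl, hns⟩
    refine ⟨D.toX x₀, D.toY x₀ y₀, VariableChange.ringHom_toX _ _ _,
      VariableChange.ringHom_toY _ _ _ _, ?_⟩
    rw [VariableChange.ringHom_toX, VariableChange.ringHom_toY, hred,
      VariableChange.nonsingular_iff]
    exact hns

end VariableChange

end Literature.NumberTheory.EllipticCurves

end
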